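import Summits.Ventures.Crystal3D.Theorems.StickyWulffConstantCoaxialWallLawChainTorsion
import Summits.Ventures.Crystal3D.Theorems.StickyWulffConstantGenericWallFloorStackLedgerOneSidedReach
import HarnessLib

/-!
# Every level-⅓ TRANSLATION pair outside the two fault cosets of the planes through a steep slot is FREE at `½κ₁`
# (crux `CoaxialWallLaw`, stmt-Ventures-19481, line `WallLedgerF`)

HONEST FRAMING. Venture `Summits/Ventures/Crystal3D` (cell `crystal3d-full`), helper `--supports` the crux `CoaxialWallLaw`
of `route-Ventures-StickyWulffConstant` (REGISTERED line `WallLedgerF`, open stub `stub_coaxialTwoSlabAdhesion`).  Rung credit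
only; F-C1 not moved; NOT the stub: `ExactOnly`(C12-55) [E1] and `StarPairFar` [certified; kernel at computational grade] stay BY
NAME; the basal stacking-fault staircases (and all twins, all deeper-level registered offsets) remain the census.

Chain torsion (`reachGroup_chainFrames_torsion`, `…ChainTorsion`) + the one-sided positional ledger
(`twoSlabLedgerAt_oneSided_reach`, `…StackLedgerOneSidedReach`):
* `oneSided_offReach_of_level_third` — for a TRANSLATION pair (`A₂·Λ₀ = A₁·Λ₀`) whose offset `t₂ − t₁` is of level ⅓
  (`3(t₂ − t₁) ∈ A₁·Λ₀`) and NOT in `A₁·Λ₀ + ℤ√(2/3)n₁ + ℤ√(2/3)n₂` (`n₁, n₂` the two `{111}` normals through the slot `u₁`),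
  grain 1's reach set over `(A₁, u₁)` misses the far affine lattice (any vertical);
* **`twoSlabLedgerAt_oneSided_of_level_third`** — if `u₁` is steep: `TwoSlabLedgerAt (½κ₁) A₁ t₁ A₂ t₂`, `½κ₁ ≥ ½`, ARBITRARY
  fillings, modulo E1/StarPairFar;
* **`coaxialTwoSlabAdhesion_of_level_third`** — `stub_coaxialTwoSlabAdhesion`'s conclusion VERBATIM for these pairs;
* **`level_third_not_mem_two_cosets`**, **`coaxialTwoSlabAdhesion_of_level_third_coords`** — the criterion in COORDINATES:
  with the zone-axis slot `u*` (`⟪u*, u₁⟫ = 0`, `⟪A₁u*, n₁⟫ = 0`) and the offset `A₁(y/3)`, `y ∈ Λ₀`: `3 ∤ 2⟪y, u*⟫` suffices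
  (`2⟪y,u*⟫ = εᵢyᵢ − εⱼyⱼ` in cubic coordinates when `u₁ = (εᵢeᵢ+εⱼeⱼ)/√2`).
READING (exact numerics agree, calc/reach*.py): of the 26 non-trivial level-⅓ translation classes `A₁(y/3)`, `y ∈ Λ₀`, the class
is registered for the steep slot `u = ε_i e_i + ε_j e_j` iff `ε_i y_i ≡ ε_j y_j (mod 3)`; with two steep slots of different
supports (walls in the 2- or 3-steep-slot cone of a `{111}` axis) only the two BASAL stacking-fault classes survive; the
inclined-plane faults, the two-partial classes `⅓·slot` and the `⅓·⟨200⟩` classes are FREE for arbitrary fillings.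
WHAT THIS IS NOT: not the stub; F-C1 not moved.
-/

noncomputable section

namespace Summit.Ventures.Crystal3D.Theorems

open Summit.Ventures.Crystal3D Finset
open Literature.MathematicalPhysics.StatisticalMechanics (fccStacking barlowStacking IsHaggSeq contactDeficiency)
open scoped InnerProductSpace

/-! ### One-sided non-arrival for level-⅓ translation pairs outside the two fault cosets -/

/-- **Grain 1's reach set misses the far affine lattice** for a TRANSLATION pair (`A₂·Λ₀ = A₁·Λ₀`) whose offset is of level
⅓ (`3(t₂ − t₁) ∈ A₁·Λ₀`) but not in `A₁·Λ₀ + ℤ√(2/3)n₁ + ℤ√(2/3)n₂` (the two fault cosets of the planes through the slot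
`u₁`); any vertical `z`. -/
theorem oneSided_offReach_of_level_third (z : EuclideanSpace ℝ (Fin 3))
    (A₁ : EuclideanSpace ℝ (Fin 3) ≃ₗᵢ[ℝ] EuclideanSpace ℝ (Fin 3)) (t₁ : EuclideanSpace ℝ (Fin 3))
    (A₂ : EuclideanSpace ℝ (Fin 3) ≃ₗᵢ[ℝ] EuclideanSpace ℝ (Fin 3)) (t₂ : EuclideanSpace ℝ (Fin 3))
    (hΛ : A₂ '' fccStacking 1 (Real.sqrt (2 / 3)) = A₁ '' fccStacking 1 (Real.sqrt (2 / 3)))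
    {u₁ n₁ : EuclideanSpace ℝ (Fin 3)} (hu₁ : u₁ ∈ fccSlots) (hn₁ : ‖n₁‖ = 1)
    (hmenu₁ : ∀ w ∈ fccSlots, ⟪A₁ w, n₁⟫_ℝ = 0 ∨ ⟪A₁ w, n₁⟫_ℝ = Real.sqrt (2 / 3) ∨ ⟪A₁ w, n₁⟫_ℝ = -Real.sqrt (2 / 3))
    (hun : ⟪A₁ u₁, n₁⟫_ℝ = Real.sqrt (2 / 3))
    (h3 : A₁.symm ((3 : ℝ) • (t₂ - t₁)) ∈ fccStacking 1 (Real.sqrt (2 / 3)))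
    (hnot : ∀ a b : ℤ, A₁.symm (t₂ - t₁ - (a : ℝ) • (Real.sqrt (2 / 3) • n₁) -
      (b : ℝ) • (Real.sqrt (2 / 3) • ((2 * Real.sqrt (2 / 3)) • A₁ u₁ - n₁))) ∉ fccStacking 1 (Real.sqrt (2 / 3))) :
    ∀ y ∈ reachSet A₁ t₁ (chainFrames z A₁ u₁), y ∉ (fun q => A₂ q + t₂) '' fccStacking 1 (Real.sqrt (2 / 3)) := by
  rintro y ⟨x₁, hx₁, v, hv, rfl⟩ ⟨x₂, hx₂, hy⟩
  have hA₂x₂ : A₂ x₂ ∈ A₁ '' fccStacking 1 (Real.sqrt (2 / 3)) := hΛ ▸ ⟨x₂, hx₂, rfl⟩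
  obtain ⟨x₂', hx₂', hx₂'eq⟩ := hA₂x₂
  -- `v = (t₂ − t₁) + A₁ x₂' − A₁ x₁`
  have hv_eq : v = (t₂ - t₁) + (A₁ x₂' - A₁ x₁) := by
    have : A₂ x₂ + t₂ = A₁ x₁ + t₁ + v := hy
    rw [hx₂'eq]
    linear_combination (norm := module) (-1 : ℝ) • this
  have hm : A₁.symm (A₁ x₂' - A₁ x₁) ∈ fccStacking 1 (Real.sqrt (2 / 3)) := by
    rw [map_sub, LinearIsometryEquiv.symm_apply_apply, LinearIsometryEquiv.symm_apply_apply]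
    exact fcc_sub_site_mem hx₂' hx₁
  have h3v : A₁.symm ((3 : ℝ) • v) ∈ fccStacking 1 (Real.sqrt (2 / 3)) := by
    rw [hv_eq, smul_add, show (3 : ℝ) • (A₁ x₂' - A₁ x₁) = ((3 : ℤ) : ℝ) • (A₁ x₂' - A₁ x₁) by norm_num]
    exact symm_mem_fcc_add A₁ h3 (symm_mem_fcc_zsmul A₁ 3 hm)
  obtain ⟨a, b, hab⟩ := reachGroup_chainFrames_torsion z A₁ hu₁ hn₁ hmenu₁ hun hv h3v
  refine hnot a b ?_
  have e : t₂ - t₁ - (a : ℝ) • (Real.sqrt (2 / 3) • n₁) - (b : ℝ) • (Real.sqrt (2 / 3) • ((2 * Real.sqrt (2 / 3)) • A₁ u₁ - n₁)) =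
      (v - (a : ℝ) • (Real.sqrt (2 / 3) • n₁) - (b : ℝ) • (Real.sqrt (2 / 3) • ((2 * Real.sqrt (2 / 3)) • A₁ u₁ - n₁))) -
      (A₁ x₂' - A₁ x₁) := by
    rw [hv_eq]; module
  rw [e]
  exact symm_mem_fcc_sub A₁ hab hm

open scoped Classical in
/-- **Lane G's one-sided ledger at charge `½κ₁` for such pairs** (vertical `e₃`, `u₁` steep), ARBITRARY fillings, modulo
`ExactOnly`(C12-55) and `StarPairFar`. -/
theorem twoSlabLedgerAt_oneSided_of_level_third
    {s₀ : EuclideanSpace ℝ (Fin 3)} (hs₀ : s₀ ∈ fccSlots)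
    (hcert : ExactOnly 0 (fccSlots.filter fun w => 0 < ⟪w, s₀⟫_ℝ)) (hSP : StarPairFar)
    (A₁ : EuclideanSpace ℝ (Fin 3) ≃ₗᵢ[ℝ] EuclideanSpace ℝ (Fin 3)) (t₁ : EuclideanSpace ℝ (Fin 3))
    (A₂ : EuclideanSpace ℝ (Fin 3) ≃ₗᵢ[ℝ] EuclideanSpace ℝ (Fin 3)) (t₂ : EuclideanSpace ℝ (Fin 3))
    (hΛ : A₂ '' fccStacking 1 (Real.sqrt (2 / 3)) = A₁ '' fccStacking 1 (Real.sqrt (2 / 3)))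
    {u₁ n₁ : EuclideanSpace ℝ (Fin 3)} (hu₁ : u₁ ∈ fccSlots)
    (hsteep₁ : Real.sqrt 2 / 2 ≤ ⟪A₁ u₁, EuclideanSpace.single (2 : Fin 3) (1 : ℝ)⟫_ℝ) (hn₁ : ‖n₁‖ = 1)
    (hmenu₁ : ∀ w ∈ fccSlots, ⟪A₁ w, n₁⟫_ℝ = 0 ∨ ⟪A₁ w, n₁⟫_ℝ = Real.sqrt (2 / 3) ∨ ⟪A₁ w, n₁⟫_ℝ = -Real.sqrt (2 / 3))
    (hun : ⟪A₁ u₁, n₁⟫_ℝ = Real.sqrt (2 / 3))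
    (h3 : A₁.symm ((3 : ℝ) • (t₂ - t₁)) ∈ fccStacking 1 (Real.sqrt (2 / 3)))
    (hnot : ∀ a b : ℤ, A₁.symm (t₂ - t₁ - (a : ℝ) • (Real.sqrt (2 / 3) • n₁) -
      (b : ℝ) • (Real.sqrt (2 / 3) • ((2 * Real.sqrt (2 / 3)) • A₁ u₁ - n₁))) ∉ fccStacking 1 (Real.sqrt (2 / 3))) :
    TwoSlabLedgerAt (Real.sqrt 2 * |⟪A₁ u₁, EuclideanSpace.single (2 : Fin 3) (1 : ℝ)⟫_ℝ| / 2) A₁ t₁ A₂ t₂ :=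
  twoSlabLedgerAt_oneSided_reach hs₀ hcert hSP A₁ t₁ A₂ t₂ hu₁ hsteep₁ _
    (fun _ hS hW hlast => frame_mem_chainFrames_of_stack hS hW hlast)
    (oneSided_offReach_of_level_third _ A₁ t₁ A₂ t₂ hΛ hu₁ hn₁ hmenu₁ hun h3 hnot)

open scoped Classical in
/-- **Lane F's stub conclusion VERBATIM for such pairs** (co-axiality data supplied for the frame `L`; the charge `½κ₁ ≥ ½`
dominates `½·√(1 − ⟪L e₃, e₃⟫²)`), ARBITRARY fillings, modulo `ExactOnly`(C12-55) and `StarPairFar`. -/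
theorem coaxialTwoSlabAdhesion_of_level_third
    {s₀ : EuclideanSpace ℝ (Fin 3)} (hs₀ : s₀ ∈ fccSlots)
    (hcert : ExactOnly 0 (fccSlots.filter fun w => 0 < ⟪w, s₀⟫_ℝ)) (hSP : StarPairFar)
    (A₁ : EuclideanSpace ℝ (Fin 3) ≃ₗᵢ[ℝ] EuclideanSpace ℝ (Fin 3)) (t₁ : EuclideanSpace ℝ (Fin 3))
    (A₂ : EuclideanSpace ℝ (Fin 3) ≃ₗᵢ[ℝ] EuclideanSpace ℝ (Fin 3)) (t₂ : EuclideanSpace ℝ (Fin 3))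
    (hco : ∃ (L : EuclideanSpace ℝ (Fin 3) ≃ₗᵢ[ℝ] EuclideanSpace ℝ (Fin 3))
        (s₁ s₂ : EuclideanSpace ℝ (Fin 3)) (σ σ' : ℤ → ℤ), IsHaggSeq σ ∧ IsHaggSeq σ' ∧
        (fun p => A₁ p + t₁) '' fccStacking 1 (Real.sqrt (2 / 3)) ⊆
          (fun p => L p + s₁) '' barlowStacking 1 (Real.sqrt (2 / 3)) σ ∧
        (fun p => A₂ p + t₂) '' fccStacking 1 (Real.sqrt (2 / 3)) ⊆
          (fun p => L p + s₂) '' barlowStacking 1 (Real.sqrt (2 / 3)) σ')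
    (hΛ : A₂ '' fccStacking 1 (Real.sqrt (2 / 3)) = A₁ '' fccStacking 1 (Real.sqrt (2 / 3)))
    {u₁ n₁ : EuclideanSpace ℝ (Fin 3)} (hu₁ : u₁ ∈ fccSlots)
    (hsteep₁ : Real.sqrt 2 / 2 ≤ ⟪A₁ u₁, EuclideanSpace.single (2 : Fin 3) (1 : ℝ)⟫_ℝ) (hn₁ : ‖n₁‖ = 1)
    (hmenu₁ : ∀ w ∈ fccSlots, ⟪A₁ w, n₁⟫_ℝ = 0 ∨ ⟪A₁ w, n₁⟫_ℝ = Real.sqrt (2 / 3) ∨ ⟪A₁ w, n₁⟫_ℝ = -Real.sqrt (2 / 3))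
    (hun : ⟪A₁ u₁, n₁⟫_ℝ = Real.sqrt (2 / 3))
    (h3 : A₁.symm ((3 : ℝ) • (t₂ - t₁)) ∈ fccStacking 1 (Real.sqrt (2 / 3)))
    (hnot : ∀ a b : ℤ, A₁.symm (t₂ - t₁ - (a : ℝ) • (Real.sqrt (2 / 3) • n₁) -
      (b : ℝ) • (Real.sqrt (2 / 3) • ((2 * Real.sqrt (2 / 3)) • A₁ u₁ - n₁))) ∉ fccStacking 1 (Real.sqrt (2 / 3))) :
    ∃ (L : EuclideanSpace ℝ (Fin 3) ≃ₗᵢ[ℝ] EuclideanSpace ℝ (Fin 3))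
        (s₁ s₂ : EuclideanSpace ℝ (Fin 3)) (σ σ' : ℤ → ℤ), IsHaggSeq σ ∧ IsHaggSeq σ' ∧
        (fun p => A₁ p + t₁) '' fccStacking 1 (Real.sqrt (2 / 3)) ⊆
          (fun p => L p + s₁) '' barlowStacking 1 (Real.sqrt (2 / 3)) σ ∧
        (fun p => A₂ p + t₂) '' fccStacking 1 (Real.sqrt (2 / 3)) ⊆
          (fun p => L p + s₂) '' barlowStacking 1 (Real.sqrt (2 / 3)) σ' ∧
    ∃ C R₀ : ℝ, 1 ≤ R₀ ∧ ∀ h : ℝ, 0 ≤ h → ∀ ρ : ℝ, R₀ ≤ ρ →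
      ∀ X P₁ P₂ : Finset (EuclideanSpace ℝ (Fin 3)),
      (∀ p ∈ X, ∀ q ∈ X, p ≠ q → 1 ≤ dist p q) → P₁ ⊆ X → P₂ ⊆ X \ P₁ →
      (∀ p ∈ X, -(2 * R₀) ≤ p 2 ∧ p 2 ≤ h + 2 * R₀ ∧ p 0 ^ 2 + p 1 ^ 2 ≤ ρ ^ 2) →
      (∀ p, p ∈ P₁ ↔ (p ∈ (fun q => A₁ q + t₁) '' fccStacking 1 (Real.sqrt (2 / 3)) ∧
        -(2 * R₀) ≤ p 2 ∧ p 2 ≤ -R₀ ∧ p 0 ^ 2 + p 1 ^ 2 ≤ ρ ^ 2)) →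
      (∀ p, p ∈ P₂ ↔ (p ∈ (fun q => A₂ q + t₂) '' fccStacking 1 (Real.sqrt (2 / 3)) ∧
        h + R₀ ≤ p 2 ∧ p 2 ≤ h + 2 * R₀ ∧ p 0 ^ 2 + p 1 ^ 2 ≤ ρ ^ 2)) →
      ((((P₁ ×ˢ (X \ P₁)).filter fun pq => dist pq.1 pq.2 = 1).card : ℕ) : ℝ) +
        ((((P₂ ×ˢ ((X \ P₁) \ P₂)).filter fun pq => dist pq.1 pq.2 = 1).card : ℕ) : ℝ) ≤
        contactDeficiency ((X \ P₁) \ P₂) +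
          (Real.sqrt 2 / 4 * ∑ᶠ w ∈ {w ∈ fccStacking 1 (Real.sqrt (2 / 3)) | ‖w‖ = 1},
              |⟪w, A₁.symm (EuclideanSpace.single (2 : Fin 3) (1 : ℝ))⟫_ℝ| +
            Real.sqrt 2 / 4 * ∑ᶠ w ∈ {w ∈ fccStacking 1 (Real.sqrt (2 / 3)) | ‖w‖ = 1},
              |⟪w, A₂.symm (EuclideanSpace.single (2 : Fin 3) (1 : ℝ))⟫_ℝ| -
            (1 / 2 : ℝ) * Real.sqrt (1 - ⟪L (EuclideanSpace.single (2 : Fin 3) (1 : ℝ)),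
              (EuclideanSpace.single (2 : Fin 3) (1 : ℝ))⟫_ℝ ^ 2)) * Real.pi * ρ ^ 2 +
          C * (1 + h) * ρ := by
  have hledger := twoSlabLedgerAt_oneSided_of_level_third hs₀ hcert hSP A₁ t₁ A₂ t₂ hΛ hu₁ hsteep₁ hn₁ hmenu₁ hun h3 hnot
  obtain ⟨L, s₁, s₂, σ, σ', hσ, hσ', hsub₁, hsub₂⟩ := hco
  have hκ₁ := one_le_flux_of_steep (A := A₁) (u := u₁) (le_trans hsteep₁ (le_abs_self _))
  have hle : (1 / 2 : ℝ) * Real.sqrt (1 - ⟪L (EuclideanSpace.single (2 : Fin 3) (1 : ℝ)),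
      (EuclideanSpace.single (2 : Fin 3) (1 : ℝ))⟫_ℝ ^ 2) ≤
      Real.sqrt 2 * |⟪A₁ u₁, EuclideanSpace.single (2 : Fin 3) (1 : ℝ)⟫_ℝ| / 2 := by
    have h1 : Real.sqrt (1 - ⟪L (EuclideanSpace.single (2 : Fin 3) (1 : ℝ)),
        (EuclideanSpace.single (2 : Fin 3) (1 : ℝ))⟫_ℝ ^ 2) ≤ 1 := by
      rw [show (1 : ℝ) = Real.sqrt 1 from Real.sqrt_one.symm]
      exact Real.sqrt_le_sqrt (by rw [Real.sqrt_one]; nlinarith [sq_nonneg ⟪L (EuclideanSpace.single (2 : Fin 3) (1 : ℝ)),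
        (EuclideanSpace.single (2 : Fin 3) (1 : ℝ))⟫_ℝ])
    linarith
  exact ⟨L, s₁, s₂, σ, σ', hσ, hσ', hsub₁, hsub₂, twoSlabLedgerAt_mono hle hledger⟩

/-! ### The criterion in coordinates: the zone-axis slot `u*` -/

/-- Twice the inner product of a lattice vector with a slot is an integer. -/
theorem exists_int_two_inner_slot {y w : EuclideanSpace ℝ (Fin 3)} (hy : y ∈ fccStacking 1 (Real.sqrt (2 / 3)))
    (hw : w ∈ fccSlots) : ∃ j : ℤ, 2 * ⟪y, w⟫_ℝ = j := by
  have val : ∀ s ∈ fccSlots, ∃ j : ℤ, 2 * ⟪s, w⟫_ℝ = j := by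
    intro s hs
    rcases inner_slots_mem hs hw with h | h | h | h | h <;> rw [h]
    · exact ⟨2, by norm_num⟩
    · exact ⟨1, by norm_num⟩
    · exact ⟨0, by norm_num⟩
    · exact ⟨-1, by norm_num⟩
    · exact ⟨-2, by norm_num⟩
  obtain ⟨i, j, k, rfl⟩ := exists_zsum_slots_of_mem_fcc hy
  obtain ⟨a, ha⟩ := val _ (slotSite_mem 0)
  obtain ⟨b, hb⟩ := val _ (slotSite_mem 4)
  obtain ⟨c, hc⟩ := val _ (slotSite_mem 8)
  refine ⟨i * a + j * b + k * c, ?_⟩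
  rw [inner_add_left, inner_add_left, inner_smul_left, inner_smul_left, inner_smul_left]
  simp only [conj_trivial]
  push_cast
  linear_combination (i : ℝ) * ha + (j : ℝ) * hb + (k : ℝ) * hc

/-- **The two-coset criterion in coordinates.**  Let `u*` be a slot orthogonal to `u₁` and to `n₁` (the ZONE AXIS of the
two planes through `u₁`).  If the offset is `A₁(y/3)` with `y ∈ Λ₀` and `3 ∤ 2⟪y, u*⟫`, then the offset is of level ⅓ and
lies outside `A₁·Λ₀ + ℤ√(2/3)n₁ + ℤ√(2/3)n₂` (both normals kill `u*`, lattice vectors pair integrally with `2u*`).  In cubic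
coordinates with `u₁ = (εᵢeᵢ + εⱼeⱼ)/√2`: `u* = (εᵢeᵢ − εⱼeⱼ)/√2` and `2⟪y,u*⟫ = εᵢyᵢ − εⱼyⱼ`. -/
theorem level_third_not_mem_two_cosets (A₁ : EuclideanSpace ℝ (Fin 3) ≃ₗᵢ[ℝ] EuclideanSpace ℝ (Fin 3))
    {t₁ t₂ u₁ n₁ ustar y : EuclideanSpace ℝ (Fin 3)}
    (hy : y ∈ fccStacking 1 (Real.sqrt (2 / 3))) (ht : t₂ - t₁ = A₁ ((3 : ℝ)⁻¹ • y))
    (hustar : ustar ∈ fccSlots) (hperp : ⟪ustar, u₁⟫_ℝ = 0) (hzone : ⟪A₁ ustar, n₁⟫_ℝ = 0)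
    {m : ℤ} (hm : 2 * ⟪y, ustar⟫_ℝ = m) (h3m : ¬ (3 : ℤ) ∣ m) :
    A₁.symm ((3 : ℝ) • (t₂ - t₁)) ∈ fccStacking 1 (Real.sqrt (2 / 3)) ∧
    ∀ a b : ℤ, A₁.symm (t₂ - t₁ - (a : ℝ) • (Real.sqrt (2 / 3) • n₁) -
      (b : ℝ) • (Real.sqrt (2 / 3) • ((2 * Real.sqrt (2 / 3)) • A₁ u₁ - n₁))) ∉ fccStacking 1 (Real.sqrt (2 / 3)) := by
  refine ⟨?_, fun a b hmem => ?_⟩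
  · rw [ht, map_smul, LinearIsometryEquiv.symm_apply_apply, smul_smul, mul_inv_cancel₀ (by norm_num : (3 : ℝ) ≠ 0),
      one_smul]; exact hy
  · -- pair the lattice vector with `u*`: both normals are killed
    set lam := A₁.symm (t₂ - t₁ - (a : ℝ) • (Real.sqrt (2 / 3) • n₁) -
      (b : ℝ) • (Real.sqrt (2 / 3) • ((2 * Real.sqrt (2 / 3)) • A₁ u₁ - n₁))) with hlam
    obtain ⟨j, hj⟩ := exists_int_two_inner_slot hmem hustar
    have hn₁' : ⟪A₁.symm n₁, ustar⟫_ℝ = 0 := by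
      rw [← LinearIsometryEquiv.inner_map_map A₁, LinearIsometryEquiv.apply_symm_apply, real_inner_comm, hzone]
    have hu₁' : ⟪u₁, ustar⟫_ℝ = 0 := by rw [real_inner_comm, hperp]
    have key : 2 * ⟪lam, ustar⟫_ℝ = 2 * ⟪(3 : ℝ)⁻¹ • y, ustar⟫_ℝ := by
      rw [hlam, ht]
      simp only [map_sub, map_smul, LinearIsometryEquiv.symm_apply_apply, inner_sub_left, inner_smul_left, hn₁', hu₁',
        conj_trivial]
      ring
    rw [hj, inner_smul_left, conj_trivial] at key
    have h3 : (m : ℝ) = 3 * j := by rw [← hm]; linarith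
    have h3' : m = 3 * j := by exact_mod_cast h3
    exact h3m ⟨j, h3'⟩

open scoped Classical in
/-- **Lane F's stub conclusion for level-⅓ translation pairs, coordinate criterion.**  Translation pair (`A₂·Λ₀ = A₁·Λ₀`) with
offset `A₁(y/3)`, `y ∈ Λ₀`; a steep slot `u₁`, a unit menu normal `n₁` of `A₁` through `A₁u₁`, and the zone-axis slot `u*`
(`⟪u*, u₁⟫ = 0`, `⟪A₁u*, n₁⟫ = 0`) with `3 ∤ 2⟪y, u*⟫` ⇒ `stub_coaxialTwoSlabAdhesion`'s conclusion, ARBITRARY fillings, modulo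
`ExactOnly`(C12-55) and `StarPairFar`.  (All level-⅓ classes except the two fault cosets of the planes through `u₁`.) -/
theorem coaxialTwoSlabAdhesion_of_level_third_coords
    {s₀ : EuclideanSpace ℝ (Fin 3)} (hs₀ : s₀ ∈ fccSlots)
    (hcert : ExactOnly 0 (fccSlots.filter fun w => 0 < ⟪w, s₀⟫_ℝ)) (hSP : StarPairFar)
    (A₁ : EuclideanSpace ℝ (Fin 3) ≃ₗᵢ[ℝ] EuclideanSpace ℝ (Fin 3)) (t₁ : EuclideanSpace ℝ (Fin 3))
    (A₂ : EuclideanSpace ℝ (Fin 3) ≃ₗᵢ[ℝ] EuclideanSpace ℝ (Fin 3)) (t₂ : EuclideanSpace ℝ (Fin 3))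
    (hco : ∃ (L : EuclideanSpace ℝ (Fin 3) ≃ₗᵢ[ℝ] EuclideanSpace ℝ (Fin 3))
        (s₁ s₂ : EuclideanSpace ℝ (Fin 3)) (σ σ' : ℤ → ℤ), IsHaggSeq σ ∧ IsHaggSeq σ' ∧
        (fun p => A₁ p + t₁) '' fccStacking 1 (Real.sqrt (2 / 3)) ⊆
          (fun p => L p + s₁) '' barlowStacking 1 (Real.sqrt (2 / 3)) σ ∧
        (fun p => A₂ p + t₂) '' fccStacking 1 (Real.sqrt (2 / 3)) ⊆
          (fun p => L p + s₂) '' barlowStacking 1 (Real.sqrt (2 / 3)) σ')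
    (hΛ : A₂ '' fccStacking 1 (Real.sqrt (2 / 3)) = A₁ '' fccStacking 1 (Real.sqrt (2 / 3)))
    {y : EuclideanSpace ℝ (Fin 3)} (hy : y ∈ fccStacking 1 (Real.sqrt (2 / 3))) (ht : t₂ - t₁ = A₁ ((3 : ℝ)⁻¹ • y))
    {u₁ n₁ ustar : EuclideanSpace ℝ (Fin 3)} (hu₁ : u₁ ∈ fccSlots)
    (hsteep₁ : Real.sqrt 2 / 2 ≤ ⟪A₁ u₁, EuclideanSpace.single (2 : Fin 3) (1 : ℝ)⟫_ℝ) (hn₁ : ‖n₁‖ = 1)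
    (hmenu₁ : ∀ w ∈ fccSlots, ⟪A₁ w, n₁⟫_ℝ = 0 ∨ ⟪A₁ w, n₁⟫_ℝ = Real.sqrt (2 / 3) ∨ ⟪A₁ w, n₁⟫_ℝ = -Real.sqrt (2 / 3))
    (hun : ⟪A₁ u₁, n₁⟫_ℝ = Real.sqrt (2 / 3))
    (hustar : ustar ∈ fccSlots) (hperp : ⟪ustar, u₁⟫_ℝ = 0) (hzone : ⟪A₁ ustar, n₁⟫_ℝ = 0)
    {m : ℤ} (hm : 2 * ⟪y, ustar⟫_ℝ = m) (h3m : ¬ (3 : ℤ) ∣ m) :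
    ∃ (L : EuclideanSpace ℝ (Fin 3) ≃ₗᵢ[ℝ] EuclideanSpace ℝ (Fin 3))
        (s₁ s₂ : EuclideanSpace ℝ (Fin 3)) (σ σ' : ℤ → ℤ), IsHaggSeq σ ∧ IsHaggSeq σ' ∧
        (fun p => A₁ p + t₁) '' fccStacking 1 (Real.sqrt (2 / 3)) ⊆
          (fun p => L p + s₁) '' barlowStacking 1 (Real.sqrt (2 / 3)) σ ∧
        (fun p => A₂ p + t₂) '' fccStacking 1 (Real.sqrt (2 / 3)) ⊆
          (fun p => L p + s₂) '' barlowStacking 1 (Real.sqrt (2 / 3)) σ' ∧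
    ∃ C R₀ : ℝ, 1 ≤ R₀ ∧ ∀ h : ℝ, 0 ≤ h → ∀ ρ : ℝ, R₀ ≤ ρ →
      ∀ X P₁ P₂ : Finset (EuclideanSpace ℝ (Fin 3)),
      (∀ p ∈ X, ∀ q ∈ X, p ≠ q → 1 ≤ dist p q) → P₁ ⊆ X → P₂ ⊆ X \ P₁ →
      (∀ p ∈ X, -(2 * R₀) ≤ p 2 ∧ p 2 ≤ h + 2 * R₀ ∧ p 0 ^ 2 + p 1 ^ 2 ≤ ρ ^ 2) →
      (∀ p, p ∈ P₁ ↔ (p ∈ (fun q => A₁ q + t₁) '' fccStacking 1 (Real.sqrt (2 / 3)) ∧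
        -(2 * R₀) ≤ p 2 ∧ p 2 ≤ -R₀ ∧ p 0 ^ 2 + p 1 ^ 2 ≤ ρ ^ 2)) →
      (∀ p, p ∈ P₂ ↔ (p ∈ (fun q => A₂ q + t₂) '' fccStacking 1 (Real.sqrt (2 / 3)) ∧
        h + R₀ ≤ p 2 ∧ p 2 ≤ h + 2 * R₀ ∧ p 0 ^ 2 + p 1 ^ 2 ≤ ρ ^ 2)) →
      ((((P₁ ×ˢ (X \ P₁)).filter fun pq => dist pq.1 pq.2 = 1).card : ℕ) : ℝ) +
        ((((P₂ ×ˢ ((X \ P₁) \ P₂)).filter fun pq => dist pq.1 pq.2 = 1).card : ℕ) : ℝ) ≤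
        contactDeficiency ((X \ P₁) \ P₂) +
          (Real.sqrt 2 / 4 * ∑ᶠ w ∈ {w ∈ fccStacking 1 (Real.sqrt (2 / 3)) | ‖w‖ = 1},
              |⟪w, A₁.symm (EuclideanSpace.single (2 : Fin 3) (1 : ℝ))⟫_ℝ| +
            Real.sqrt 2 / 4 * ∑ᶠ w ∈ {w ∈ fccStacking 1 (Real.sqrt (2 / 3)) | ‖w‖ = 1},
              |⟪w, A₂.symm (EuclideanSpace.single (2 : Fin 3) (1 : ℝ))⟫_ℝ| -
            (1 / 2 : ℝ) * Real.sqrt (1 - ⟪L (EuclideanSpace.single (2 : Fin 3) (1 : ℝ)),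
              (EuclideanSpace.single (2 : Fin 3) (1 : ℝ))⟫_ℝ ^ 2)) * Real.pi * ρ ^ 2 +
          C * (1 + h) * ρ := by
  obtain ⟨h3, hnot⟩ := level_third_not_mem_two_cosets A₁ hy ht hustar hperp hzone hm h3m
  exact coaxialTwoSlabAdhesion_of_level_third hs₀ hcert hSP A₁ t₁ A₂ t₂ hco hΛ hu₁ hsteep₁ hn₁ hmenu₁ hun h3 hnot

end Summit.Ventures.Crystal3D.Theorems

end
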